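import Literature.Combinatorics.Sahi2008.CycleForm

/-!
# The without-replacement / pattern device AT EVERY ORDER `n` AND EVERY DIMENSION `d`:
# `E_n` under a product weight on a `d`-dimensional grid is a nonnegative combination of values of ONE finite functional on the slot cube `[n]^d` — I, THE BRIDGE

Support file of the one-cut programme (crux `NoHeavyLowerTail`, stmt-CriticalPhenomena-4575; cell `prim-masterthm`, seat P3, gen 18;
`run/shared/lean/prim/prim-masterthm/prim-masterthm-p3/HIERARCHY.md` §26).

Two programmes of the tree reduce Sahi positivity under PRODUCT weights to finite statements on a "slot cube":
* seat P3 (this lane), ORDER `n`, dimension 2: the without-replacement functional `SahiTwoChain.et` on the slot grid `[n]²` and the coefficient bridge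
  `SahiTwoChain.sahiE_prodWeight_eq_sum_et` (gen 16; Lieb–Sahi coefficientwise), and `(d,n) = (3,3)` (`SahiThreeChain.sahiE_three_prodWeight3_eq`, gen 17);
* cell prim-sahi (seat p1), ORDER 3, every dimension `d`: the pattern functional `SahiGridPattern.sStarD` on `[3]^d`, `PatternPos d`,
  `kahnConjecture_of_forall_patternPos` (…SahiGridPattern*, 2026-08-20/21).
This file does BOTH AT ONCE — every order `n`, every dimension `d` — with a short proof that needs no recursion and no counting of rook placements:

* `SahiSlot.rep σ i` — the least element of the cycle of `σ ∈ S_n` through `i`; **`SahiSlot.cycleE_eq_sum_rep`**: for a probability weight `μ`,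
  `E_σ(f) = Π_{cycles c} E_μ[Π_{i∈c} f_i] = Σ_{y : Fin n → X} (Π_j μ(y_j)) · Π_i f_i(y_{rep σ i})` ("one independent sample per cycle").
* `SahiSlot.diagForm d n h = Σ_σ (−1)^{C_σ−1} Π_i h_i(diag(rep σ i))` on the slot cube `Q = (Fin d → Fin n)`, and the EXACT, unsymmetrised bridge
  **`SahiSlot.sahiE_gridW_eq_sum_diagForm`**: `E_n^{⊗g}(f) = Σ_{r : Fin d → Fin n → Y} (Π_a Π_j g_a(r_a j)) · diagForm(f ∘ slot_r)`, `slot_r(q)_a = r_a(q_a)`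
  (Lieb–Sahi's cycle form + the representative lemma + the transposition `(Fin n → Fin d → Y) ≃ (Fin d → Fin n → Y)`).
* `SahiSlot.patternForm d n h = Σ_{τ ∈ S_n^d} diagForm(h ∘ τ)` (per-axis relabellings), invariant under relabelling (`patternForm_comp_act`), and the symmetrised
  bridge **`SahiSlot.card_mul_sahiE_gridW_eq_sum_patternForm`**: `(n!)^d · E_n^{⊗g}(f) = Σ_r w(r) · patternForm(f ∘ slot_r)`.  On indicators of sets `U_i ⊆ Q`,
  `patternForm = Σ_σ (−1)^{C_σ−1} ((n − C_σ)!)^d · #{cycle-indexed tuples of points of Q, pairwise distinct in EVERY coordinate, the point of c in ∩_{i∈c} U_i}`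
  — the order-`n` pattern functional; at `n = 3` it is prim-sahi's `sStarD`, at `d = 2` it is `(n!)²·SahiTwoChain.et` (both up to the indexing conventions).
The SEQUEL `…SahiSlotPatternPositivity` states the finite obligation `SlotPatternPos d n` (`patternForm ≥ 0` on up-set tuples of `Q`) and derives, by sorting,
`SlotPatternPos d n → LiebSahiContinuum d n`, `(∀ d, SlotPatternPos d n) → SahiConjecture n`, the Kahn form, and antitonicity in `d`.
HONEST LABEL: identities only (no positivity is asserted here).  Everything proved; axioms standard. [this work]
-/

noncomputable section

namespace Summit.CriticalPhenomena.PercolationContinuityZ3.Theorems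

open Finset Function Equiv Equiv.Perm
open Literature.Combinatorics.Sahi2008 Literature.Combinatorics.Sahi2008.CycleForm

namespace SahiSlot

/-! ### Cycle representatives and "one independent sample per cycle" -/

section Rep

variable {n : ℕ}

/-- The least element of the cycle of `σ` through `i` — a canonical representative of the cycle. [this work] -/
def rep (σ : Perm (Fin n)) (i : Fin n) : Fin n := (orbit σ i).min' ⟨i, self_mem_orbit σ i⟩

/-- The representative lies on the cycle. [this work] -/
theorem rep_mem (σ : Perm (Fin n)) (i : Fin n) : rep σ i ∈ orbit σ i := Finset.min'_mem _ _

/-- `i` and its representative are on the same cycle. [this work] -/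
theorem sameCycle_rep (σ : Perm (Fin n)) (i : Fin n) : SameCycle σ i (rep σ i) := mem_orbit.1 (rep_mem σ i)

/-- Points on the same cycle have the same representative. [this work] -/
theorem rep_eq_of_sameCycle {σ : Perm (Fin n)} {i j : Fin n} (h : SameCycle σ i j) : rep σ i = rep σ j := by
  have h1 : orbit σ i = orbit σ j := orbit_eq_orbit_of_sameCycle h
  simp only [rep, h1]

/-- The representative of a representative is itself. [this work] -/
theorem rep_rep (σ : Perm (Fin n)) (i : Fin n) : rep σ (rep σ i) = rep σ i := (rep_eq_of_sameCycle (sameCycle_rep σ i)).symm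

/-- For a representative `j`, the fibre `{i : rep i = j}` is the cycle of `j`. [this work] -/
theorem rep_eq_iff {σ : Perm (Fin n)} {j : Fin n} (hj : rep σ j = j) (i : Fin n) : rep σ i = j ↔ SameCycle σ j i := by
  constructor
  · intro h
    rw [← h]
    exact (sameCycle_rep σ i).symm
  · intro h
    rw [← rep_eq_of_sameCycle h, hj]

/-- The cycle of `i` is the cycle of its representative. [this work] -/
theorem orbit_rep (σ : Perm (Fin n)) (i : Fin n) : orbit σ (rep σ i) = orbit σ i := (orbit_eq_orbit_of_sameCycle (sameCycle_rep σ i)).symm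

/-- The set of cycles is the image of the set of representatives under `orbit`. [this work] -/
theorem orbits_eq_image_reps (σ : Perm (Fin n)) : orbits σ = (univ.filter fun j => rep σ j = j).image (orbit σ) := by
  ext B
  simp only [orbits, mem_image, mem_univ, true_and, mem_filter]
  constructor
  · rintro ⟨i, rfl⟩
    exact ⟨rep σ i, rep_rep σ i, orbit_rep σ i⟩
  · rintro ⟨j, _, rfl⟩
    exact ⟨j, rfl⟩

/-- `orbit σ` is injective on representatives. [this work] -/
theorem orbit_injOn_reps (σ : Perm (Fin n)) : Set.InjOn (orbit σ) ↑(univ.filter fun j : Fin n => rep σ j = j) := by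
  intro j hj j' hj' h
  rw [coe_filter] at hj hj'
  have hs : SameCycle σ j j' := by rw [← mem_orbit, h]; exact self_mem_orbit σ j'
  rw [← hj.2, ← hj'.2]
  exact rep_eq_of_sameCycle hs

variable {X : Type*} [Fintype X]

/-- **One independent sample per cycle**: for a probability weight `μ`,
`E_σ(f) = Π_{c ∈ cycles σ} E_μ[Π_{i∈c} f_i] = Σ_{y : Fin n → X} (Π_j μ(y_j)) · Π_i f_i(y_{rep σ i})` — the coordinates `y_j` at representatives `j` carry the
cycle products, the other coordinates integrate to `1`. [this work] -/
theorem cycleE_eq_sum_rep (μ : X → ℝ) (hμ : ∑ x, μ x = 1) (f : Fin n → X → ℝ) (σ : Perm (Fin n)) :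
    cycleE μ f σ = ∑ y : Fin n → X, (∏ j, μ (y j)) * ∏ i, f i (y (rep σ i)) := by
  classical
  -- regroup the product over `i` along the fibres of `rep σ`
  have hfib : ∀ y : Fin n → X, ∏ i, f i (y (rep σ i)) = ∏ j, ∏ i ∈ univ.filter (fun i => rep σ i = j), f i (y j) := by
    intro y
    rw [← Finset.prod_fiberwise_of_maps_to (g := rep σ) (t := univ) (fun i _ => mem_univ _)]
    refine prod_congr rfl fun j _ => prod_congr rfl fun i hi => ?_
    rw [mem_filter] at hi
    rw [hi.2]
  have hrw : ∀ y : Fin n → X, (∏ j, μ (y j)) * ∏ i, f i (y (rep σ i)) =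
      ∏ j, (μ (y j) * ∏ i ∈ univ.filter (fun i => rep σ i = j), f i (y j)) := by
    intro y
    rw [hfib, prod_mul_distrib]
  simp_rw [hrw]
  rw [← Fintype.prod_sum (fun j x => μ x * ∏ i ∈ univ.filter (fun i => rep σ i = j), f i x)]
  -- now `∏ j, E_μ[Π_{i : rep i = j} f_i]`; non-representatives contribute `E_μ[1] = 1`
  rw [← Finset.prod_filter_mul_prod_filter_not univ (fun j => rep σ j = j)]
  have hnot : ∏ j ∈ univ.filter (fun j => ¬ rep σ j = j), ∑ x, μ x * ∏ i ∈ univ.filter (fun i => rep σ i = j), f i x = 1 := by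
    refine prod_eq_one fun j hj => ?_
    rw [mem_filter] at hj
    have hemp : univ.filter (fun i => rep σ i = j) = ∅ := by
      rw [Finset.filter_eq_empty_iff]
      intro i _ h
      exact hj.2 (by rw [← h, rep_rep])
    simp [hemp, hμ]
  rw [hnot, mul_one]
  -- representatives ↔ cycles
  unfold cycleE
  rw [orbits_eq_image_reps, Finset.prod_image (orbit_injOn_reps σ)]
  refine prod_congr rfl fun j hj => ?_
  rw [mem_filter] at hj
  unfold ex
  refine sum_congr rfl fun x _ => ?_
  congr 1
  refine prod_congr ?_ fun _ _ => rfl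
  ext i
  simp only [mem_filter, mem_univ, true_and, mem_orbit]
  exact (rep_eq_iff hj.2 i).symm

end Rep

/-! ### The slot cube `[n]^d`, the diagonal form, the pattern functional -/

section Forms

variable {d n : ℕ}

/-- The slot cube `Q = [n]^d = (Fin d → Fin n)`. [this work] -/
abbrev Q (d n : ℕ) := Fin d → Fin n

/-- The diagonal point `(j,…,j)` of the slot cube. [this work] -/
def diag (j : Fin n) : Q d n := fun _ => j

/-- **The diagonal form** `D(h) = Σ_{σ ∈ S_n} (−1)^{C_σ − 1} Π_i h_i(diag(rep σ i))` (Lieb–Sahi's cycle form with every cycle read at ONE diagonal point of the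
slot cube). [this work] -/
def diagForm (d n : ℕ) (h : Fin n → Q d n → ℝ) : ℝ :=
  ∑ σ : Perm (Fin n), (-1 : ℝ) ^ ((orbits σ).card - 1) * ∏ i, h i (diag (rep σ i))

/-- Per-axis relabelling of the slot cube by `τ ∈ S_n^d`: `(τ·q)_a = τ_a(q_a)`. [this work] -/
def act (τ : Fin d → Perm (Fin n)) (q : Q d n) : Q d n := fun a => τ a (q a)

/-- Relabellings compose: `τ'·(τ·q) = (τ'τ)·q`. [this work] -/
theorem act_act (τ' τ : Fin d → Perm (Fin n)) (q : Q d n) : act τ' (act τ q) = act (τ' * τ) q := by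
  funext a; simp [act, Perm.mul_apply]

/-- **The pattern functional** (order `n`, dimension `d`): the diagonal form symmetrised over all per-axis relabellings,
`patternForm h = Σ_{τ ∈ S_n^d} D(h ∘ τ)`.  On indicators it counts, with the signs and factorials of the cycle form, cycle-indexed tuples of points of the slot
cube that are pairwise distinct in every coordinate. [this work] -/
def patternForm (d n : ℕ) (h : Fin n → Q d n → ℝ) : ℝ :=
  ∑ τ : Fin d → Perm (Fin n), diagForm d n (fun i => h i ∘ act τ)

/-- **Relabelling invariance**: `patternForm (h ∘ τ') = patternForm h` for every `τ' ∈ S_n^d`. [this work] -/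
theorem patternForm_comp_act (h : Fin n → Q d n → ℝ) (τ' : Fin d → Perm (Fin n)) :
    patternForm d n (fun i => h i ∘ act τ') = patternForm d n h := by
  unfold patternForm
  have hc : ∀ τ : Fin d → Perm (Fin n), (fun i => (h i ∘ act τ') ∘ act τ) = fun i => h i ∘ act (τ' * τ) := by
    intro τ; funext i q; simp only [comp_apply, act_act]
  simp_rw [hc]
  exact Fintype.sum_equiv (Equiv.mulLeft τ') _ _ fun τ => rfl

variable {Y : Type*}

/-- The slot map of `r : Fin d → Fin n → Y`: `slot_r(q)_a = r_a(q_a)`, a map from the slot cube to the grid `Fin d → Y`. [this work] -/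
def slotMap (r : Fin d → Fin n → Y) : Q d n → (Fin d → Y) := fun q a => r a (q a)

/-- The slot map, pointwise. [this work] -/
theorem slotMap_apply (r : Fin d → Fin n → Y) (q : Q d n) : slotMap r q = fun a => r a (q a) := rfl

/-- Relabelling the slots = precomposing the slot map: `slot_{r∘τ} = slot_r ∘ τ`. [this work] -/
theorem slotMap_comp_act (r : Fin d → Fin n → Y) (τ : Fin d → Perm (Fin n)) :
    slotMap (fun a => r a ∘ τ a) = slotMap r ∘ act τ := rfl

/-- A slot map with every axis monotone is monotone on the slot cube. [this work] -/
theorem slotMap_mono [Preorder Y] {r : Fin d → Fin n → Y} (hr : ∀ a, Monotone (r a)) : Monotone (slotMap r) :=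
  fun _ _ hqq' a => hr a (hqq' a)

/-- The product ("grid") weight `w(x) = Π_a g_a(x_a)` on the grid `Fin d → Y`. [this work] -/
def gridW [Fintype Y] (g : Fin d → Y → ℝ) : (Fin d → Y) → ℝ := fun x => ∏ a, g a (x a)

/-- The monomial weight of a family of slot maps, `Π_a Π_j g_a(r_a j)`. [this work] -/
def slotW (g : Fin d → Y → ℝ) (r : Fin d → Fin n → Y) : ℝ := ∏ a, ∏ j, g a (r a j)

/-- The grid weight is a probability weight when every `g_a` is. [this work] -/
theorem sum_gridW [Fintype Y] (g : Fin d → Y → ℝ) (hg : ∀ a, ∑ y, g a y = 1) : ∑ x : Fin d → Y, gridW g x = 1 := by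
  unfold gridW
  rw [← Fintype.prod_sum (fun a y => g a y)]
  exact prod_eq_one fun a _ => hg a

/-- The grid weight is nonnegative when every `g_a` is. [this work] -/
theorem gridW_nonneg [Fintype Y] {g : Fin d → Y → ℝ} (hg : ∀ a y, 0 ≤ g a y) (x : Fin d → Y) : 0 ≤ gridW g x :=
  prod_nonneg fun a _ => hg a _

/-- The monomial weight is invariant under relabelling the slots. [this work] -/
theorem slotW_comp (g : Fin d → Y → ℝ) (r : Fin d → Fin n → Y) (τ : Fin d → Perm (Fin n)) :
    slotW g (fun a => r a ∘ τ a) = slotW g r := by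
  unfold slotW
  exact prod_congr rfl fun a _ => Equiv.prod_comp (τ a) (fun j => g a (r a j))

/-- **THE BRIDGE, exact form**: for a probability grid weight and `n ≥ 1`,
`E_n^{⊗g}(f) = Σ_{r : Fin d → Fin n → Y} (Π_a Π_j g_a(r_a j)) · D(f ∘ slot_r)` — Lieb–Sahi's cycle form, one independent sample per cycle, and the transposition
`(Fin n → Fin d → Y) ≃ (Fin d → Fin n → Y)`. [this work] -/
theorem sahiE_gridW_eq_sum_diagForm [Fintype Y] (g : Fin d → Y → ℝ) (hg : ∀ a, ∑ y, g a y = 1) (hn : 1 ≤ n) (f : Fin n → (Fin d → Y) → ℝ) :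
    sahiE (gridW g) n f = ∑ r : Fin d → Fin n → Y, slotW g r * diagForm d n (fun i => f i ∘ slotMap r) := by
  classical
  rw [sahiE_eq_sahiECycle _ n hn]
  unfold sahiECycle
  simp_rw [cycleE_eq_sum_rep (gridW g) (sum_gridW g hg) f, mul_sum]
  rw [sum_comm]
  -- reindex `y : Fin n → Fin d → Y` as `r : Fin d → Fin n → Y`, `r a j = y j a`
  rw [← (Equiv.piComm fun (_ : Fin d) (_ : Fin n) => Y).sum_comp]
  refine Fintype.sum_congr _ _ fun r => ?_
  unfold diagForm
  rw [mul_sum]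
  refine sum_congr rfl fun σ _ => ?_
  have hw : (∏ j, gridW g ((Equiv.piComm fun (_ : Fin d) (_ : Fin n) => Y) r j)) = slotW g r := by
    unfold gridW slotW
    rw [Finset.prod_comm]
    rfl
  rw [hw]
  have hp : (∏ i, f i ((Equiv.piComm fun (_ : Fin d) (_ : Fin n) => Y) r (rep σ i))) = ∏ i, (f i ∘ slotMap r) (diag (rep σ i)) :=
    prod_congr rfl fun i _ => rfl
  rw [hp]
  ring

/-- **THE BRIDGE, symmetrised form**: `|S_n^d| · E_n^{⊗g}(f) = Σ_r (Π_a Π_j g_a(r_a j)) · patternForm(f ∘ slot_r)`. [this work] -/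
theorem card_mul_sahiE_gridW_eq_sum_patternForm [Fintype Y] (g : Fin d → Y → ℝ) (hg : ∀ a, ∑ y, g a y = 1) (hn : 1 ≤ n)
    (f : Fin n → (Fin d → Y) → ℝ) :
    (Fintype.card (Fin d → Perm (Fin n)) : ℝ) * sahiE (gridW g) n f =
      ∑ r : Fin d → Fin n → Y, slotW g r * patternForm d n (fun i => f i ∘ slotMap r) := by
  classical
  have hτ : ∀ τ : Fin d → Perm (Fin n), sahiE (gridW g) n f =
      ∑ r : Fin d → Fin n → Y, slotW g r * diagForm d n (fun i => (f i ∘ slotMap r) ∘ act τ) := by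
    intro τ
    rw [sahiE_gridW_eq_sum_diagForm g hg hn f]
    -- reindex `r ↦ r ∘ τ`
    obtain ⟨e, he⟩ : ∃ e : (Fin d → Fin n → Y) ≃ (Fin d → Fin n → Y), ∀ r, e r = fun a => r a ∘ τ a :=
      ⟨Equiv.piCongrRight fun a => (τ a).symm.arrowCongr (Equiv.refl Y), fun r => by
        funext a j; simp [Equiv.arrowCongr_apply]⟩
    rw [← e.sum_comp]
    refine Fintype.sum_congr _ _ fun r => ?_
    rw [he, slotW_comp]
    rfl
  rw [← nsmul_eq_mul, ← Finset.card_univ, ← Finset.sum_const, Finset.sum_congr rfl fun τ _ => hτ τ, Finset.sum_comm]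
  refine sum_congr rfl fun r _ => ?_
  rw [← mul_sum]
  rfl

end Forms

end SahiSlot

end Summit.CriticalPhenomena.PercolationContinuityZ3.Theorems
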